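import Literature.MathematicalPhysics.QuantumFieldTheory.Balaban1983to89.B1Ineq326HiggsModel
import Literature.MathematicalPhysics.QuantumFieldTheory.Balaban1983to89.B1Eq338Bridge

/-!
# `Balaban1983to89.B1Ineq326UnitLattice` — T. Bałaban, *(Higgs)₂,₃ quantum fields in a finite volume. I. A lower bound*,
Commun. Math. Phys. **85** (1982) 603–626 [Balaban1982Higgs1]: the induction of Sect. 3 for the (Higgs)₂,₃ model
(`…B1Ineq326HiggsModel`) with the printed analytic input of each step placed WHERE THE PAPER STATES IT — on the rescaled
lattices of (3.38) p. 618–619 (*"The first step in the calculation is a rescaling of all the fields and the propagators from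
L^kε-lattice T^{(k)}_{L^kε} to 1-lattice T^{(k)}_1. After the rescaling the integral transforms into … (3.38)"*), i.e. the
lower bound (3.55)/(3.60) of the bracket `const·∫dA∫dφ χ_k(A)χ_k(φ)exp[…]` of (3.38) on the unit lattice — and the last
operation of p. 623 (*"The last operation is a rescaling of the expression we got from the L-lattice for the fields B, ψ to
the L^{k+1}ε-lattice T^{(k+1)}_{L^{k+1}ε}"*) PERFORMED: the `(k+1)`-st action on the `L^{k+1}ε`-lattice is the unit-lattice
expression read through the inverse of the canonical rescaling (1.22), and the step hypothesis `h360` of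
`B1Ineq326HiggsModel` on the `L^{k+1}ε`-lattice FOLLOWS from the unit-lattice bound by this seat's (3.38) identity
`B1Eq338Rescaling.doubleRTk_rescale` and the covariance (3.8)–(3.9)/(3.27)–(3.28) of the characteristic functions
(`B1Eq38Rescale`, typer)

statement-level skeleton of published theorems with citation tags; proofs where landed; nothing here is a claim about the Yang–Mills mass gap

PDF held: `paper:balaban1982-cmp85-higgs23-i` (journal page = PDF page + 602); pp. 607, 613, 618–619, 622–623 READ AS IMAGES
on the ×2 renders `run/shared/lean/pub/pub-balaban/b2b-balaban-ref1/pages/1982-cmp85-higgs23-I/…-p0{05,11,16,17,20,21}-x2.png`.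

CITATION HEADER (lean-in-tree rule).  lit-balaban typed skeleton (HOME `run/shared/lean/pub/lit-balaban/`), SKELETON rows
**B1.Eq3.26** (decl of record `B1LowerBound.IndHyp326`; model instance `B1Ineq326HiggsModel.ineq326_model`, this seat) and
**B1.Eq3.37–3.38** (the (3.38) member: `B1Eq338Rescaling.doubleRTk_rescale`, p248048; model objects identified
`B1Eq338Bridge.doubleRTk_rescale_model`, p248937).  THIS FILE knits them: (3.26) for the model from hypotheses stated on the
rescaled lattices.
DICTIONARY.  Rescaling by a factor `s > 0` (printed: `s = (L^kε)⁻¹ = B1Eq338Rescaling.unitScale P k`, so that `T^{(k)}_{L^kε}`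
becomes the unit lattice `T^{(k)}_1` and `T^{(k+1)}_{L^{k+1}ε}` the `L`-lattice `T^{(k+1)}_L`, `B1Eq338Rescaling.unit_mesh_k`/
`unit_mesh_succ`): the lattice family `P.scaleBy s` (`HiggsRescaling`), fields `A = σA′`, `φ = σφ′`, `σ = s^{(d−2)/2}` (1.22)
(`HiggsRescaling.rescaleVec`/`rescaleScalar`); the INVERSE maps `A′ = σ⁻¹A`, `φ′ = σ⁻¹φ` (`unrescaleVec`/`unrescaleScalar`,
§1).  On the rescaled family the characteristic functions are those of `B1Ineq326HiggsModel.chiW` at the scales `sℓ_k`, charge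
`e_s = ChargeData.scaleBy`, masses `μ₀²s⁻²`, `m²s⁻²` (p. 607; `chiW_rescale`, §2, from `B1Eq38Rescale.chi0A/chi0φ/chiKA/
chiKφ_rescale`) and the external fields those of `extW` with mass `μ₀²s⁻²` (`hext_extW`, from `B1Eq338Bridge.hext_bgVec`).
The bracket of (3.38): `B1Eq338Rescaling.rescaleConstK P k N a s · ∫dA′∫dφ′ χ^{s}_k(A′)χ^{s}_k(A′,φ′)·exp(stepExponent^{s}(B′,ψ′;
A′,φ′))` (`doubleRTk_chiW_rescale`, §3 = (3.38) for the densities of the induction at every level, INCLUDING the first step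
`k = 0` with the external field `A`).  THE UNIT-LATTICE STEP HYPOTHESIS `hunit` (displayed; the content of pp. 619–623 and
[III]): on the support of `χ^{s}_{k+1}(B′)χ^{s}_{k+1}(B′,ψ′)`, `exp(−S^{u}_{k+1}(B′,ψ′))·exp(−C(L^kε)^{κ₀}|T_ε|) ≦` the bracket
of (3.38) at `(B′,ψ′)` — (3.51) ≧ (3.55), (3.56) ≧ (3.60) with the `(k+1)`-st action `S^{u}_{k+1}` (`−log(const Z_kZ_k(B^{(k+1)})
·Gaussian normalizations) + ½⟨B′,Δ^{(k+1),L}B′⟩ + ½⟨ψ′,Δ^{(k+1),L}(B^{(k+1)})ψ′⟩ − 𝒫^{(k+1),L}(B^{(k+1)},ψ′) + E₀`, cf. (3.30))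
ON THE `L`-LATTICE; the `(k+1)`-st action on `T^{(k+1)}_{L^{k+1}ε}` is then `S_{k+1}(B,ψ) := S^{u}_{k+1}(σ⁻¹B, σ⁻¹ψ)`
(`actionSeq`, §4 — *"rescaling … to the L^{k+1}ε-lattice"*).

WHAT THIS FILE PROVES (0 `sorry`; standard axioms).  §1 `unrescaleVec`, `unrescaleScalar` and the four inverse laws;
§2 `chiW_rescale`, `hext_extW`; §3 **`doubleRTk_chiW_rescale`** — (3.38) for the induction densities `χ_kχ_k e^{−S_k}` at
every level `k ≧ 0`; §4 `actionSeq`; **`h360_of_unit`** — the unit-lattice bound `hunit` at level `k` IMPLIES the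
`L^{k+1}ε`-lattice step hypothesis `h360` of `B1Ineq326HiggsModel.step326_model` for `S_{k+1} = S^{u}_{k+1} ∘ σ⁻¹`
(surjectivity of (1.22) + §3); **`ineq326_model_unit`** — (3.26) for every `k ≦ K` for the model from the unit-lattice
bounds at the levels `k < K` (any scales `s_k > 0`); `ineq326_model_unitScale` — the printed scales `s_k = (L^kε)⁻¹`.
HONEST SCOPE.  As in `B1Ineq326HiggsModel`: `hunit` is displayed, not proved (Props. 3.1/3.2, (3.59), [III]); the constant
`const` of (3.38) (`rescaleConstK`) stays inside the hypothesis exactly as printed in (3.38)/(3.55); no convergence beyond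
`exp(−S_k) ∈ L¹` is used.  Unit `lit-balaban-p14` gen 7 (Phase-2 proof seat p14, literature-prover-lit-balaban-p14-g7-0), HOME
`run/shared/lean/pub/lit-balaban/` (seat log `lit-balaban-p14/STATUS.md`).
-/

open scoped BigOperators
open _root_.MeasureTheory

namespace Literature.MathematicalPhysics.QuantumFieldTheory.Balaban1983to89.B1Ineq326UnitLattice

open Literature.MathematicalPhysics.QuantumFieldTheory.Balaban1983to89
open Literature.MathematicalPhysics.QuantumFieldTheory.Balaban1983to89.HiggsLattice
open Literature.MathematicalPhysics.QuantumFieldTheory.Balaban1983to89.HiggsRescaling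
open Literature.MathematicalPhysics.QuantumFieldTheory.Balaban1983to89.HiggsDoubleRT
open Literature.MathematicalPhysics.QuantumFieldTheory.Balaban1983to89.B1Eq338Rescaling
  (stepExponent rescaleConstK doubleRTk_rescale unitScale unitScale_pos)
open Literature.MathematicalPhysics.QuantumFieldTheory.Balaban1983to89.B1Eq38Rescale
  (chi0A_rescale chi0φ_rescale chiKA_rescale chiKφ_rescale)
open Literature.MathematicalPhysics.QuantumFieldTheory.Balaban1983to89.B1Eq338Bridge (hext_bgVec)
open Literature.MathematicalPhysics.QuantumFieldTheory.Balaban1983to89.B1Ineq326HiggsModel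
  (chiW extW run326 chiW_mem_Icc ineq326_model)
open Finset (range)

variable {P : Params} {N k : ℕ} {s : ℝ}

/-! ## 1. The inverse of the canonical rescaling (1.22) -/

section Inverse

/-- The inverse of (1.22) p. 607 for vector fields: from `A` on the `L^kε`-lattice of the family `P` to `A′ = σ⁻¹A`
(`σ = s^{(d−2)/2}`, same bond labels) on the `sL^kε`-lattice of the rescaled family. [cite: Balaban1982Higgs1, (1.22) p.607] -/
noncomputable def unrescaleVec (hs : 0 < s) (A : VecField P k) : VecField (P.scaleBy s hs) k :=
  fun b => (s ^ (((P.d : ℝ) - 2) / 2))⁻¹ * A ⟨b.src, b.dir⟩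

/-- The inverse of (1.22) p. 607 for scalar fields: `φ′ = σ⁻¹φ`. [cite: Balaban1982Higgs1, (1.22) p.607] -/
noncomputable def unrescaleScalar (hs : 0 < s) (φ : ScalarField P k N) : ScalarField (P.scaleBy s hs) k N :=
  fun x => (s ^ (((P.d : ℝ) - 2) / 2))⁻¹ • φ x

/-- `σ(σ⁻¹A) = A`. [cite: Balaban1982Higgs1, (1.22) p.607] -/
theorem rescaleVec_unrescaleVec (hs : 0 < s) (A : VecField P k) : rescaleVec hs (unrescaleVec hs A) = A := by
  have hσ : s ^ (((P.d : ℝ) - 2) / 2) ≠ 0 := (Real.rpow_pos_of_pos hs _).ne'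
  funext b
  simp only [rescaleVec, unrescaleVec]
  rw [← mul_assoc, mul_inv_cancel₀ hσ, one_mul]

/-- `σ⁻¹(σA′) = A′`. [cite: Balaban1982Higgs1, (1.22) p.607] -/
theorem unrescaleVec_rescaleVec (hs : 0 < s) (A' : VecField (P.scaleBy s hs) k) :
    unrescaleVec hs (rescaleVec hs A') = A' := by
  have hσ : s ^ (((P.d : ℝ) - 2) / 2) ≠ 0 := (Real.rpow_pos_of_pos hs _).ne'
  funext b
  simp only [rescaleVec, unrescaleVec]
  rw [← mul_assoc, inv_mul_cancel₀ hσ, one_mul]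

/-- `σ(σ⁻¹φ) = φ`. [cite: Balaban1982Higgs1, (1.22) p.607] -/
theorem rescaleScalar_unrescaleScalar (hs : 0 < s) (φ : ScalarField P k N) :
    rescaleScalar hs (unrescaleScalar hs φ) = φ := by
  have hσ : s ^ (((P.d : ℝ) - 2) / 2) ≠ 0 := (Real.rpow_pos_of_pos hs _).ne'
  funext x
  simp only [rescaleScalar, unrescaleScalar, smul_smul, mul_inv_cancel₀ hσ, one_smul]

/-- `σ⁻¹(σφ′) = φ′`. [cite: Balaban1982Higgs1, (1.22) p.607] -/
theorem unrescaleScalar_rescaleScalar (hs : 0 < s) (φ' : ScalarField (P.scaleBy s hs) k N) :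
    unrescaleScalar hs (rescaleScalar hs φ') = φ' := by
  have hσ : s ^ (((P.d : ℝ) - 2) / 2) ≠ 0 := (Real.rpow_pos_of_pos hs _).ne'
  funext x
  simp only [rescaleScalar, unrescaleScalar, smul_smul, inv_mul_cancel₀ hσ, one_smul]

end Inverse

/-! ## 2. The characteristic functions and the external fields of the induction on the rescaled lattices -/

section Covariance

variable (C : ChargeData N) (ℓ p : ℕ → ℝ) {mu0sq msq a : ℝ}

/-- **(3.8)–(3.9) p. 613 / (3.27)–(3.29) p. 617 under (1.22)**: the weights of the induction are covariant —
`χ_k(σA′)χ_k(σA′, σφ′) = χ^{s}_k(A′)χ^{s}_k(A′, φ′)`, the right side being `B1Ineq326HiggsModel.chiW` of the rescaled family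
at the scales `sℓ_k`, charge `e_s`, masses `μ₀²s⁻²`, `m²s⁻²` (the typer's `B1Eq38Rescale.chi0A/chi0φ_rescale` at `k = 0`,
`chiKA/chiKφ_rescale` for `k ≧ 1`). [cite: Balaban1982Higgs1, (3.8)–(3.9) p.613; (3.27)–(3.28) p.617] -/
theorem chiW_rescale (hs : 0 < s) (hℓ : ∀ k, 0 < ℓ k) (hmu : 0 < mu0sq) (hmsq : 0 < msq) (ha : 0 ≤ a) :
    ∀ (k : ℕ) (A' : VecField (P.scaleBy s hs) k) (φ' : ScalarField (P.scaleBy s hs) k N),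
      chiW C ℓ p mu0sq msq a k (rescaleVec hs A') (rescaleScalar hs φ')
        = chiW (P := P.scaleBy s hs) (C.scaleBy P.d s) (fun j => s * ℓ j) p (mu0sq * s⁻¹ ^ 2) (msq * s⁻¹ ^ 2) a k A' φ'
  | 0, A', φ' => by
    simp only [chiW]
    rw [chi0A_rescale hs (hℓ 0), chi0φ_rescale hs (hℓ 0)]
  | k + 1, A', φ' => by
    simp only [chiW]
    rw [chiKA_rescale hs (hℓ (k + 1)) _ hmu ha, chiKφ_rescale hs (hℓ (k + 1)) C _ hmu hmsq ha]

/-- The external fields of the induction are compatible with (1.22) (the hypothesis `hext` of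
`B1Eq338Rescaling.doubleRTk_rescale`): `σ·Ã^{s}_k(A′) = Ã_k(σA′)` — trivially at `k = 0` (`Ã₀(A) = A`), by
`B1Eq338Bridge.hext_bgVec` (`A^{(k),ε}[σA′] = σA^{(k),sε}_{μ₀²s⁻²}[A′]`) for `k ≧ 1`. [cite: Balaban1982Higgs1, (3.29) p.617; (1.22) p.607] -/
theorem hext_extW (hs : 0 < s) (hmu : 0 < mu0sq) (ha : 0 ≤ a) :
    ∀ (k : ℕ) (A' : VecField (P.scaleBy s hs) k),
      rescaleVec hs (extW (P := P.scaleBy s hs) (mu0sq * s⁻¹ ^ 2) a k A') = extW mu0sq a k (rescaleVec hs A')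
  | 0, _ => rfl
  | k + 1, A' => hext_bgVec hs hmu ha (k + 1) A'

end Covariance

/-! ## 3. (3.38) for the densities of the induction, at every level -/

section Bracket

variable (C : ChargeData N) (ℓ p : ℕ → ℝ) {mu0sq msq a : ℝ}

/-- **(3.38) p. 618–619 for the `(k+1)`-st step of the induction, `k ≧ 0`**: at the rescalings `σB′`, `σψ′` of block fields
of the rescaled family,
`T^{L^kε}_{a,L}[T^{L^kε}_{a,L,Ã_k}[χ_kχ_k e^{−S_k}]](σB′, σψ′) = const · ∫dA′∫dφ′ χ^{s}_k(A′)χ^{s}_k(A′,φ′)·exp(stepExponent^{s}(B′,ψ′;A′,φ′))`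
— this seat's `B1Eq338Rescaling.doubleRTk_rescale` (the sentence *"After the rescaling the integral transforms into"*) with
the weights and external fields of the induction identified on the rescaled family (`chiW_rescale`, `hext_extW`); `const =
rescaleConstK P k N a s`; the pulled-back action `S_k(σ·, σ·)` inside the bracket. [cite: Balaban1982Higgs1, (3.38) p.619] -/
theorem doubleRTk_chiW_rescale (hs : 0 < s) (hℓ : ∀ k, 0 < ℓ k) (hmu : 0 < mu0sq) (hmsq : 0 < msq) (ha : 0 ≤ a) (k : ℕ)
    (Sk : VecField P k → ScalarField P k N → ℝ) (B' : VecField (P.scaleBy s hs) (k + 1))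
    (ψ' : ScalarField (P.scaleBy s hs) (k + 1) N) :
    doubleRTk C a (extW mu0sq a k) (fun A φ => chiW C ℓ p mu0sq msq a k A φ * Real.exp (-Sk A φ))
        (rescaleVec hs B') (rescaleScalar hs ψ')
      = rescaleConstK P k N a s
          * ∫ A' : VecField (P.scaleBy s hs) k, ∫ φ' : ScalarField (P.scaleBy s hs) k N,
              chiW (P := P.scaleBy s hs) (C.scaleBy P.d s) (fun j => s * ℓ j) p (mu0sq * s⁻¹ ^ 2) (msq * s⁻¹ ^ 2) a k A' φ'
                * Real.exp (stepExponent (P := P.scaleBy s hs) (C.scaleBy P.d s) a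
                    (extW (P := P.scaleBy s hs) (mu0sq * s⁻¹ ^ 2) a k)
                    (fun A φ => Sk (rescaleVec hs A) (rescaleScalar hs φ)) B' ψ' A' φ') := by
  rw [doubleRTk_rescale hs C a (hext_extW (P := P) hs hmu ha k) _ Sk B' ψ']
  simp only [chiW_rescale C ℓ p hs hℓ hmu hmsq ha]

end Bracket

/-! ## 4. From the unit-lattice bound to the step hypothesis on the `L^{k+1}ε`-lattice, and (3.26) -/

section Transport

variable (C : ChargeData N) (ℓ p : ℕ → ℝ) {mu0sq msq a : ℝ}

/-- **p. 623: "The last operation is a rescaling of the expression we got from the L-lattice for the fields B, ψ to the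
L^{k+1}ε-lattice."** — if the bracket of (3.38) is bounded below on the support of `χ^{s}_{k+1}(B′)χ^{s}_{k+1}(B′,ψ′)` by
`exp(−S^{u}_{k+1}(B′,ψ′))·exp(−C(L^kε)^{κ₀}|T_ε|)` ((3.51) ≧ (3.55), (3.56) ≧ (3.60): `hunit`), then the step hypothesis
`h360` of `B1Ineq326HiggsModel.step326_model` holds on the `L^{k+1}ε`-lattice for the rescaled action
`S_{k+1}(B,ψ) = S^{u}_{k+1}(σ⁻¹B, σ⁻¹ψ)` (every block field is a rescaled one, §1; then §3).
[cite: Balaban1982Higgs1, (3.60) p.623; (3.38) p.619] -/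
theorem h360_of_unit (hs : 0 < s) (hℓ : ∀ k, 0 < ℓ k) (hmu : 0 < mu0sq) (hmsq : 0 < msq) (ha : 0 ≤ a) (k : ℕ)
    (Sk : VecField P k → ScalarField P k N → ℝ)
    (Su : VecField (P.scaleBy s hs) (k + 1) → ScalarField (P.scaleBy s hs) (k + 1) N → ℝ) {E : ℝ}
    (hunit : ∀ (B' : VecField (P.scaleBy s hs) (k + 1)) (ψ' : ScalarField (P.scaleBy s hs) (k + 1) N),
      chiW (P := P.scaleBy s hs) (C.scaleBy P.d s) (fun j => s * ℓ j) p (mu0sq * s⁻¹ ^ 2) (msq * s⁻¹ ^ 2) a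
          (k + 1) B' ψ' ≠ 0 →
        Real.exp (-Su B' ψ') * Real.exp (-E)
          ≤ rescaleConstK P k N a s
              * ∫ A' : VecField (P.scaleBy s hs) k, ∫ φ' : ScalarField (P.scaleBy s hs) k N,
                  chiW (P := P.scaleBy s hs) (C.scaleBy P.d s) (fun j => s * ℓ j) p (mu0sq * s⁻¹ ^ 2) (msq * s⁻¹ ^ 2)
                      a k A' φ'
                    * Real.exp (stepExponent (P := P.scaleBy s hs) (C.scaleBy P.d s) a
                        (extW (P := P.scaleBy s hs) (mu0sq * s⁻¹ ^ 2) a k)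
                        (fun A φ => Sk (rescaleVec hs A) (rescaleScalar hs φ)) B' ψ' A' φ')) :
    ∀ (B : VecField P (k + 1)) (ψ : ScalarField P (k + 1) N), chiW C ℓ p mu0sq msq a (k + 1) B ψ ≠ 0 →
      Real.exp (-Su (unrescaleVec hs B) (unrescaleScalar hs ψ)) * Real.exp (-E)
        ≤ doubleRTk C a (extW mu0sq a k) (fun A φ => chiW C ℓ p mu0sq msq a k A φ * Real.exp (-Sk A φ)) B ψ := by
  intro B ψ hne
  have hB : B = rescaleVec hs (unrescaleVec hs B) := (rescaleVec_unrescaleVec hs B).symm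
  have hψ : ψ = rescaleScalar hs (unrescaleScalar hs ψ) := (rescaleScalar_unrescaleScalar hs ψ).symm
  set B' := unrescaleVec hs B
  set ψ' := unrescaleScalar hs ψ
  rw [hB, hψ] at hne ⊢
  rw [chiW_rescale C ℓ p hs hℓ hmu hmsq ha] at hne
  rw [doubleRTk_chiW_rescale C ℓ p hs hℓ hmu hmsq ha k Sk]
  exact hunit B' ψ' hne

/-- **The actions of the induction with the last rescaling performed**: `S_0 = S^{(0)}` on `T_ε` (printed: `S^ε`) and, for
each `k`, the `(k+1)`-st action on `T^{(k+1)}_{L^{k+1}ε}` obtained from the expression `S^{u}_{k+1}` on the `L`-lattice of the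
`s_k`-rescaled family (printed `s_k = (L^kε)⁻¹`) by `S_{k+1}(B,ψ) = S^{u}_{k+1}(σ_k⁻¹B, σ_k⁻¹ψ)` (p. 623, *"rescaling … to the
L^{k+1}ε-lattice … we get … (3.26)–(3.32) but with k+1 instead of k"*). [cite: Balaban1982Higgs1, (3.60) p.623; (3.30) p.617] -/
noncomputable def actionSeq (S0 : VecField P 0 → ScalarField P 0 N → ℝ) (sc : ℕ → ℝ) (hsc : ∀ k, 0 < sc k)
    (Su : (k : ℕ) → VecField (P.scaleBy (sc k) (hsc k)) (k + 1) → ScalarField (P.scaleBy (sc k) (hsc k)) (k + 1) N → ℝ) :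
    (k : ℕ) → VecField P k → ScalarField P k N → ℝ
  | 0 => S0
  | k + 1 => fun B ψ => Su k (unrescaleVec (hsc k) B) (unrescaleScalar (hsc k) ψ)

/-- **(3.26) p. 617 for the (Higgs)₂,₃ model, every `k ≦ K`, from the printed bounds ON THE RESCALED LATTICES**: for `a > 0`,
`μ₀², m² > 0`, positive threshold scales, an initial action `S_0` and unit-lattice expressions `S^{u}_{k+1}` with all
`exp(−S_k) ∈ L¹`, scales `s_k > 0`, and constants `C`, `κ₀` such that at every level `k < K` the bracket of (3.38) on the
`s_k`-rescaled family is bounded below on the support of `χ^{s_k}_{k+1}χ^{s_k}_{k+1}` by `exp(−S^{u}_{k+1})·exp(−C(L^kε)^{κ₀}|T_ε|)`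
(`hunit`: (3.51)/(3.55)/(3.56)/(3.60)), the cut-off integrals of the actions `actionSeq` satisfy
`(∫dA∫dφ χ_kχ_k exp(−S_k))·exp(−CΣ_{j<k}(L^jε)^{κ₀}|T_ε|) ≦ ∫dA∫dφ exp(−S_0)` — `B1Ineq326HiggsModel.ineq326_model` with its
`h360` supplied by `h360_of_unit`. [cite: Balaban1982Higgs1, (3.26) p.617; (3.38) p.619; (3.60) p.623] -/
theorem ineq326_model_unit (ha : 0 < a) (hmu : 0 < mu0sq) (hmsq : 0 < msq) (hℓ : ∀ k, 0 < ℓ k) (K : ℕ)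
    (S0 : VecField P 0 → ScalarField P 0 N → ℝ) (sc : ℕ → ℝ) (hsc : ∀ k, 0 < sc k)
    (Su : (k : ℕ) → VecField (P.scaleBy (sc k) (hsc k)) (k + 1) → ScalarField (P.scaleBy (sc k) (hsc k)) (k + 1) N → ℝ)
    (hS : ∀ k, k ≤ K →
      Integrable fun Φ : VecField P k × ScalarField P k N => Real.exp (-actionSeq S0 sc hsc Su k Φ.1 Φ.2))
    {Cst κ₀ : ℝ}
    (hunit : ∀ k, k < K → ∀ (B' : VecField (P.scaleBy (sc k) (hsc k)) (k + 1))
      (ψ' : ScalarField (P.scaleBy (sc k) (hsc k)) (k + 1) N),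
      chiW (P := P.scaleBy (sc k) (hsc k)) (C.scaleBy P.d (sc k)) (fun j => sc k * ℓ j) p (mu0sq * (sc k)⁻¹ ^ 2)
          (msq * (sc k)⁻¹ ^ 2) a (k + 1) B' ψ' ≠ 0 →
        Real.exp (-Su k B' ψ') * Real.exp (-(Cst * P.mesh k ^ κ₀ * P.vol 0 Finset.univ))
          ≤ rescaleConstK P k N a (sc k)
              * ∫ A' : VecField (P.scaleBy (sc k) (hsc k)) k, ∫ φ' : ScalarField (P.scaleBy (sc k) (hsc k)) k N,
                  chiW (P := P.scaleBy (sc k) (hsc k)) (C.scaleBy P.d (sc k)) (fun j => sc k * ℓ j) p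
                      (mu0sq * (sc k)⁻¹ ^ 2) (msq * (sc k)⁻¹ ^ 2) a k A' φ'
                    * Real.exp (stepExponent (P := P.scaleBy (sc k) (hsc k)) (C.scaleBy P.d (sc k)) a
                        (extW (P := P.scaleBy (sc k) (hsc k)) (mu0sq * (sc k)⁻¹ ^ 2) a k)
                        (fun A φ => actionSeq S0 sc hsc Su k (rescaleVec (hsc k) A) (rescaleScalar (hsc k) φ))
                        B' ψ' A' φ')) :
    ∀ k, k ≤ K →
      (∫ Φ : VecField P k × ScalarField P k N,
          chiW C ℓ p mu0sq msq a k Φ.1 Φ.2 * Real.exp (-actionSeq S0 sc hsc Su k Φ.1 Φ.2))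
          * Real.exp (-(Cst * (∑ j ∈ range k, P.mesh j ^ κ₀) * P.vol 0 Finset.univ))
        ≤ ∫ Φ : VecField P 0 × ScalarField P 0 N, Real.exp (-S0 Φ.1 Φ.2) :=
  ineq326_model C ℓ p mu0sq ha hmsq K (actionSeq S0 sc hsc Su) hS fun k hk =>
    h360_of_unit C ℓ p (hsc k) hℓ hmu hmsq ha.le k (actionSeq S0 sc hsc Su k) (Su k) (hunit k hk)

/-- **The printed scales**: with `s_k = (L^kε)⁻¹` (`B1Eq338Rescaling.unitScale`) the `s_k`-rescaled family has the level-`k`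
lattice of spacing `1` (`T^{(k)}_1`), the level-`(k+1)` lattice of spacing `L` (`T^{(k+1)}_L`) and the finest lattice of spacing
`η = L^{−k}` — `B1Eq338Rescaling.unit_mesh_k`/`unit_mesh_succ`/`unit_mesh_zero`; `ineq326_model_unit` at these scales is (3.26)
from the bounds stated on the unit lattices exactly as in (3.38)–(3.60). [cite: Balaban1982Higgs1, (3.38) p.619; (3.26) p.617] -/
theorem ineq326_model_unitScale (ha : 0 < a) (hmu : 0 < mu0sq) (hmsq : 0 < msq) (hℓ : ∀ k, 0 < ℓ k) (K : ℕ)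
    (S0 : VecField P 0 → ScalarField P 0 N → ℝ)
    (Su : (k : ℕ) → VecField (P.scaleBy (unitScale P k) (unitScale_pos P k)) (k + 1) →
      ScalarField (P.scaleBy (unitScale P k) (unitScale_pos P k)) (k + 1) N → ℝ)
    (hS : ∀ k, k ≤ K → Integrable fun Φ : VecField P k × ScalarField P k N =>
      Real.exp (-actionSeq S0 (unitScale P) (unitScale_pos P) Su k Φ.1 Φ.2))
    {Cst κ₀ : ℝ}
    (hunit : ∀ k, k < K → ∀ (B' : VecField (P.scaleBy (unitScale P k) (unitScale_pos P k)) (k + 1))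
      (ψ' : ScalarField (P.scaleBy (unitScale P k) (unitScale_pos P k)) (k + 1) N),
      chiW (P := P.scaleBy (unitScale P k) (unitScale_pos P k)) (C.scaleBy P.d (unitScale P k))
          (fun j => unitScale P k * ℓ j) p (mu0sq * (unitScale P k)⁻¹ ^ 2) (msq * (unitScale P k)⁻¹ ^ 2) a
          (k + 1) B' ψ' ≠ 0 →
        Real.exp (-Su k B' ψ') * Real.exp (-(Cst * P.mesh k ^ κ₀ * P.vol 0 Finset.univ))
          ≤ rescaleConstK P k N a (unitScale P k)
              * ∫ A' : VecField (P.scaleBy (unitScale P k) (unitScale_pos P k)) k,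
                  ∫ φ' : ScalarField (P.scaleBy (unitScale P k) (unitScale_pos P k)) k N,
                  chiW (P := P.scaleBy (unitScale P k) (unitScale_pos P k)) (C.scaleBy P.d (unitScale P k))
                      (fun j => unitScale P k * ℓ j) p (mu0sq * (unitScale P k)⁻¹ ^ 2) (msq * (unitScale P k)⁻¹ ^ 2)
                      a k A' φ'
                    * Real.exp (stepExponent (P := P.scaleBy (unitScale P k) (unitScale_pos P k))
                        (C.scaleBy P.d (unitScale P k)) a
                        (extW (P := P.scaleBy (unitScale P k) (unitScale_pos P k)) (mu0sq * (unitScale P k)⁻¹ ^ 2) a k)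
                        (fun A φ => actionSeq S0 (unitScale P) (unitScale_pos P) Su k
                          (rescaleVec (unitScale_pos P k) A) (rescaleScalar (unitScale_pos P k) φ))
                        B' ψ' A' φ')) :
    ∀ k, k ≤ K →
      (∫ Φ : VecField P k × ScalarField P k N,
          chiW C ℓ p mu0sq msq a k Φ.1 Φ.2 * Real.exp (-actionSeq S0 (unitScale P) (unitScale_pos P) Su k Φ.1 Φ.2))
          * Real.exp (-(Cst * (∑ j ∈ range k, P.mesh j ^ κ₀) * P.vol 0 Finset.univ))
        ≤ ∫ Φ : VecField P 0 × ScalarField P 0 N, Real.exp (-S0 Φ.1 Φ.2) :=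
  ineq326_model_unit C ℓ p ha hmu hmsq hℓ K S0 (unitScale P) (unitScale_pos P) Su hS hunit

end Transport

end Literature.MathematicalPhysics.QuantumFieldTheory.Balaban1983to89.B1Ineq326UnitLattice
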